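import Summits.ABC.IUTFork.Cor312VolumesPadicPerm
import HarnessLib

/-!
# [IUTchIII] Corollary 3.12, statement — the log-shell LATTICES of the real prime packets: (Ind1)/(Ind2)
# descend along the comparison to bijections FIXING them; boundedness; absorption; the unramified case

Record-only file (D-0012) of the abc-iut cell (Cor. 3.12 sub-crew, seat abc-iut-c312-5, gen 3; D-0067 TEAM A row
A-0 «finiteness + BridgeHyps at the real setting», the `ThetaFinite` leftover, real-instance half — the generic
half over `Cor312.Setting.ofComparison` is abc-iut-c312-7's `Cor312ThetaFiniteReal`); TAKES NO SIDE. The first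
clause "`−|log(Θ)| ∈ ℝ`" of [IUTchIII] Cor. 3.12 (kurims `paper:url-4b091feeb646` p. 174 l. 16) is obtained in
the proof's opening paragraph (p. 175 l. 2–4) "from the [easily verified] compactness of the `^{1,∘}𝒰_{j,v_ℚ}`",
the unions of the possible images of the Θ-pilot object under (Ind1), (Ind2), (Ind3). Dupuy–Hilado
(arXiv:2004.13228 §4 intro, §4.7, §4.9) make the mechanism explicit: "elements of Ind1 are just automorphisms …
induced by automorphisms of the `ℤ_p`-lattice `I^{⊗ j+1}_{V̲,p} = ⊕_{v⃗} I_{v⃗}`", "This map … fixes the lattice",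
"the Ind2 indeterminacies also preserve this lattice". THIS FILE proves that mechanism ON THE REAL PRIME
PACKETS of a `p`-adic presentation `P` of c312-1's log-shell carriers (`Cor312VolumesPadicSummands`; the
instance for c312-5's `Real.logShellsDH` is `Real.padicPresentationDH`), WITHOUT any statement about the kernel
of the comparison `e : 𝓘^ℚ(^{S^±_{j+1}};𝒟^⊢_{v_ℚ}) → Π_{v⃗} X_{v⃗}` (pure set algebra on preimages):

* `summandLattice c = Π_{v⃗} c·I_{v⃗}` (`I_{v⃗}` = abc-iut-c312-3's `logShell = (2p)^{−(j+1)}·log_p(R^×_{v⃗})`) and its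
  preimage `latticePk c = e⁻¹(Π_{v⃗} c·I_{v⃗})` in the algebraic packet;
* DESCENT: the comparison intertwines every capsule permutation with the summand permutation `permΨ`
  (`comparison_permute`) and every factor-and-summand-wise family with a summandwise `⊗_a g'_a`
  (`comparison_factorwise`) — the explicit maps behind gen-2's `GeneratorsPreserve` — and these bijections map
  `summandLattice c` ONTO itself (`permΨ_image_summandLattice`, `congr_image_summandLattice`); hence EVERY
  (Ind1)- or (Ind2)-family of c312-1 maps `latticePk c` onto itself (`family_image_latticePk`: the hypothesis
  `hW` of c312-7's `hullDefined_of_stable` / the descent datum of `hullDefined_of_descent`);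
* companion `Cor312VolumesPadicLatticeBounds`: the lattice in FIELD-FACTOR coordinates is bounded (campaign-S
  `isCompact_imageLogPacket`) and a neighbourhood of `0` (so it absorbs every bounded family of Θ-boxes), and
  in the unramified case it is the unit polydisc of log-volume `0` ([IUTchIV] Thm. 1.10 Step (vi)).
[claim: Mochizuki2012, status: disputed] for the quoted sentences; [cite: DupuyHilado2025, §4 (intro), §4.7, §4.9].
Deliberately NOT here: Θ-boxes, the `Cor312.Setting` (companion `Cor312ThetaFiniteDHVol` over c312-5's
`Real.settingDHVol`), any judgement.
-/

noncomputable section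

open Set Function PiTensorProduct Bornology
open scoped TensorProduct Pointwise

namespace Summit.ABC

namespace IUTFork

namespace Cor312Vol

open Thm311 Literature.IUT.LogThetaLattice Literature.IUT.LogVolume Literature.LinearAlgebra.BaseChange

variable {T : ThetaIndex}

/-- Pure set algebra behind "(Ind1), (Ind2) fix the lattice" read through a comparison map: if `e ∘ Φ = Ψ ∘ e`
with `Φ` onto and `Ψ` one-to-one mapping `Λ` onto itself, then `Φ` maps `e⁻¹(Λ)` onto itself — no hypothesis on
the kernel of `e`. [folklore] -/
theorem image_preimage_eq_of_semiconj {α β : Type*} {e : α → β} {Φ : α → α} (hΦ : Function.Surjective Φ)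
    {Ψ : β → β} (hΨ : Function.Injective Ψ) (h : ∀ x, e (Φ x) = Ψ (e x)) {Λ : Set β} (hΛ : Ψ '' Λ = Λ) :
    Φ '' (e ⁻¹' Λ) = e ⁻¹' Λ := by
  apply Set.Subset.antisymm
  · rintro _ ⟨x, hx, rfl⟩
    show e (Φ x) ∈ Λ
    rw [h, ← hΛ]
    exact ⟨e x, hx, rfl⟩
  · intro y hy
    obtain ⟨x, rfl⟩ := hΦ y
    refine ⟨x, ?_, rfl⟩
    have hx : Ψ (e x) ∈ Ψ '' Λ := by rw [hΛ, ← h]; exact hy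
    obtain ⟨z, hz, hzx⟩ := hx
    show e x ∈ Λ
    rwa [← hΨ hzx]

namespace PadicPresentation

variable {L : LogShells T} {vQ : T.VQ} {p : ℕ} [hp : Fact p.Prime] (P : PadicPresentation L vQ p)

/-! ## 1. The log-shell lattices `Π_{v⃗} c·I_{v⃗}` of the real prime packets -/

section Lattice

variable {j : T.Label}

/-- **The log-shell lattice of the real `(j+1)`-packet over `p`, scaled by `c`**: `Π_{v⃗} c·I_{v⃗}` with
`I_{v⃗} = I_{v̲_0} ⊗ ⋯ ⊗ I_{v̲_j} = (2p)^{−(j+1)}·log_p(R^×_{v⃗})` abc-iut-c312-3's `logShell` of the summand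
`X_{v⃗} = K_{v_0} ⊗_{ℚ_p} ⋯ ⊗_{ℚ_p} K_{v_j}` (Dupuy–Hilado §4 intro: "`I^{⊗ j+1}_{V̲,p} := ⊕_{v⃗} I_{v⃗}`").
[cite: DupuyHilado2025, §4 (intro)] -/
def summandLattice (j : T.Label) (c : ℚ_[p]) : Set (∀ e : T.Caps j → T.Fibre vQ, P.X e) :=
  Set.pi univ fun e => c • logShell p (P.kk e)

/-- Its preimage `e⁻¹(Π_{v⃗} c·I_{v⃗})` in the algebraic packet `𝓘^ℚ(^{S^±_{j+1}};𝒟^⊢_{v_ℚ})` — the stable set `W` of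
c312-7's `hullDefined_of_stable`. [cite: DupuyHilado2025, §4 (intro)] -/
def latticePk (j : T.Label) (c : ℚ_[p]) : Set (L.Packet j vQ) := P.comparison j ⁻¹' P.summandLattice j c

/-- Membership in `Π_{v⃗} c·I_{v⃗}`. [folklore] -/
theorem mem_summandLattice_iff (c : ℚ_[p]) (y : ∀ e : T.Caps j → T.Fibre vQ, P.X e) :
    y ∈ P.summandLattice j c ↔ ∀ e, y e ∈ c • logShell p (P.kk e) := by
  simp [summandLattice]

/-- An element of c312-3's (Ind2)-group of a summand maps `c·I_{v⃗}` onto itself ("the Ind2 indeterminacies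
also preserve this lattice"). [cite: DupuyHilado2025, §4.9] -/
theorem image_smul_logShell_of_mem_indTwo {e : T.Caps j → T.Fibre vQ} {ψ : P.X e ≃ₗ[ℚ_[p]] P.X e}
    (hψ : ψ ∈ indTwo p (P.kk e)) (c : ℚ_[p]) :
    ψ '' (c • logShell p (P.kk e)) = c • logShell p (P.kk e) := by
  rw [image_const_smul p (P.kk e) ψ c, image_logShell_of_mem p (P.kk e) hψ]

/-- The factor permutation `perm_σ : X_{v⃗∘σ} ≃ X_{v⃗}` maps `c·I_{v⃗∘σ}` onto `c·I_{v⃗}` ("This map … fixes the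
lattice"). [cite: DupuyHilado2025, §4.7] -/
theorem permX_image_smul_logShell (σ : Equiv.Perm (T.Caps j)) (e : T.Caps j → T.Fibre vQ) (c : ℚ_[p]) :
    P.permX σ e '' (c • logShell p (P.kk (e ∘ σ))) = c • logShell p (P.kk e) := by
  show ⇑(permAlgEquiv p (P.kk e) σ) '' (c • logShell p (fun i => P.kk e (σ i))) = c • logShell p (P.kk e)
  rw [image_const_smul_perm]
  unfold logShell
  rw [image_const_smul_perm, image_logPacket_perm]

/-- **(Ind1), permutation part, fixes `Π_{v⃗} c·I_{v⃗}`**: the summand permutation `permΨ σ` maps the lattice onto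
itself. [cite: DupuyHilado2025, §4.7] -/
theorem permΨ_image_summandLattice (σ : Equiv.Perm (T.Caps j)) (c : ℚ_[p]) :
    P.permΨ σ '' P.summandLattice j c = P.summandLattice j c := by
  unfold summandLattice
  rw [permΨ_image_pi]
  exact congrArg (Set.pi univ) (funext fun e => P.permX_image_smul_logShell σ e c)

/-- **(Ind2)-type summandwise families fix `Π_{v⃗} c·I_{v⃗}`**: for `ℚ_p`-linear `g'_{a,v}` preserving
`log_p(𝒪^×_{K_v})`, the summandwise map `y ↦ (⊗_a g'_{a,v⃗ a})(y_{v⃗})` maps the lattice onto itself.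
[cite: DupuyHilado2025, §4.9] -/
theorem congr_image_summandLattice (g' : T.Caps j → ∀ v : T.Fibre vQ, P.k v ≃ₗ[ℚ_[p]] P.k v)
    (hlog : ∀ i v, g' i v '' logUnits (P.k v) = logUnits (P.k v)) (c : ℚ_[p]) :
    (fun (y : ∀ e : T.Caps j → T.Fibre vQ, P.X e) e =>
        (PiTensorProduct.congr fun a => g' a (e a) : P.X e ≃ₗ[ℚ_[p]] P.X e) (y e)) '' P.summandLattice j c =
      P.summandLattice j c := by
  unfold summandLattice
  have h := Set.piMap_image_univ_pi
    (fun e : T.Caps j → T.Fibre vQ => ⇑(PiTensorProduct.congr fun a => g' a (e a) : P.X e ≃ₗ[ℚ_[p]] P.X e))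
    (fun e => c • logShell p (P.kk e))
  rw [show (fun (y : ∀ e : T.Caps j → T.Fibre vQ, P.X e) e =>
      (PiTensorProduct.congr fun a => g' a (e a) : P.X e ≃ₗ[ℚ_[p]] P.X e) (y e)) =
      Pi.map (fun e => ⇑(PiTensorProduct.congr fun a => g' a (e a) : P.X e ≃ₗ[ℚ_[p]] P.X e)) from rfl, h]
  exact congrArg (Set.pi univ) (funext fun e =>
    P.image_smul_logShell_of_mem_indTwo (P.congr_mem_indTwo e _ fun a => hlog a (e a)) c)

/-! ## 2. Descent of (Ind1), (Ind2) along the comparison (the explicit maps of gen-2's `GeneratorsPreserve`) -/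

/-- **The comparison intertwines a capsule permutation with the summand permutation**:
`e(permute σ · x) = permΨ σ (e x)`. [cite: DupuyHilado2025, §4.7] -/
theorem comparison_permute (σ : Equiv.Perm (T.Caps j)) (x : L.Packet j vQ) :
    P.comparison j (L.permute j vQ σ x) = P.permΨ σ (P.comparison j x) := by
  funext e
  have key : (LinearMap.proj e ∘ₗ P.comparison j) ∘ₗ (L.permute j vQ σ).toLinearMap =
      ((P.permX σ e).toLinearMap.restrictScalars ℚ) ∘ₗ (LinearMap.proj (e ∘ σ) ∘ₗ P.comparison j) := by
    refine PiTensorProduct.ext (MultilinearMap.ext fun y => ?_)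
    simp only [LinearMap.compMultilinearMap_apply]
    change P.comparison j (L.permute j vQ σ (L.tprod j vQ y)) e =
      P.permX σ e (P.comparison j (tprod ℚ y) (e ∘ σ))
    rw [L.permute_tprod]
    change P.comparison j (tprod ℚ fun i => y (σ.symm i)) e = _
    rw [comparison_tprod, comparison_tprod]
    change _ = P.permX σ e (tprod ℚ_[p] fun a => (P.φ (e (σ a))) (y a (e (σ a))))
    rw [permX_apply]
    refine Eq.trans (congrArg _ (funext fun b => ?_))
      (permLinearEquiv_tprod p (P.kk e) σ fun a => P.φ (e (σ a)) (y a (e (σ a)))).symm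
    obtain ⟨a, rfl⟩ := σ.surjective b
    rw [Equiv.piCongrLeft_apply_apply, Equiv.symm_apply_apply]
  exact LinearMap.congr_fun key x

/-- **The comparison intertwines a factor-and-summand-wise family with a summandwise `⊗_a g'_a`**: for `g_{i,v}`
intertwined through `φ_v` with `ℚ_p`-linear `g'_{i,v}`, `e(⊗_i ⊕_v g_{i,v} · x)_{v⃗} = (⊗_{a} g'_{a,v⃗ a})(e(x)_{v⃗})`.
[cite: DupuyHilado2025, §4.9] -/
theorem comparison_factorwise (g : T.Caps j → ∀ v : T.Fibre vQ, L.carrier v.1 ≃ₗ[ℚ] L.carrier v.1)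
    (g' : T.Caps j → ∀ v : T.Fibre vQ, P.k v ≃ₗ[ℚ_[p]] P.k v)
    (hg' : ∀ i v x, P.φ v (g i v x) = g' i v (P.φ v x)) (x : L.Packet j vQ) :
    P.comparison j (L.factorwise j vQ (fun i => L.summandwise vQ (g i)) x) =
      fun e => (PiTensorProduct.congr fun a => g' a (e a) : P.X e ≃ₗ[ℚ_[p]] P.X e) (P.comparison j x e) := by
  funext e
  have key : (LinearMap.proj e ∘ₗ P.comparison j) ∘ₗ
        (L.factorwise j vQ (fun i => L.summandwise vQ (g i))).toLinearMap =
      ((PiTensorProduct.congr fun a => g' a (e a) : P.X e ≃ₗ[ℚ_[p]] P.X e).toLinearMap.restrictScalars ℚ) ∘ₗ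
        (LinearMap.proj e ∘ₗ P.comparison j) := by
    refine PiTensorProduct.ext (MultilinearMap.ext fun y => ?_)
    simp only [LinearMap.compMultilinearMap_apply]
    change P.comparison j (L.factorwise j vQ (fun i => L.summandwise vQ (g i)) (L.tprod j vQ y)) e =
      (PiTensorProduct.congr fun a => g' a (e a) : P.X e ≃ₗ[ℚ_[p]] P.X e) (P.comparison j (tprod ℚ y) e)
    rw [L.factorwise_summandwise_tprod]
    change P.comparison j (tprod ℚ fun i => fun v => g i v (y i v)) e = _
    rw [comparison_tprod, comparison_tprod]
    simp only [PiTensorProduct.congr_tprod]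
    exact congrArg _ (funext fun a => hg' a (e a) (y a (e a)))
  exact LinearMap.congr_fun key x

/-! ## 3. Every (Ind1)/(Ind2)-family maps `e⁻¹(Π_{v⃗} c·I_{v⃗})` onto itself -/

/-- `permute σ` maps `latticePk c` onto itself. [cite: DupuyHilado2025, §4.7] -/
theorem permute_image_latticePk (σ : Equiv.Perm (T.Caps j)) (c : ℚ_[p]) :
    L.permute j vQ σ '' P.latticePk j c = P.latticePk j c :=
  image_preimage_eq_of_semiconj (L.permute j vQ σ).surjective (P.permΨ σ).injective (P.comparison_permute σ)
    (P.permΨ_image_summandLattice σ c)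

/-- A factor-and-summand-wise family intertwined with shell-preserving `ℚ_p`-linear maps maps `latticePk c` onto
itself. [cite: DupuyHilado2025, §4.9] -/
theorem factorwise_image_latticePk (g : T.Caps j → ∀ v : T.Fibre vQ, L.carrier v.1 ≃ₗ[ℚ] L.carrier v.1)
    (g' : T.Caps j → ∀ v : T.Fibre vQ, P.k v ≃ₗ[ℚ_[p]] P.k v)
    (hg' : ∀ i v x, P.φ v (g i v x) = g' i v (P.φ v x))
    (hlog : ∀ i v, g' i v '' logUnits (P.k v) = logUnits (P.k v)) (c : ℚ_[p]) :
    L.factorwise j vQ (fun i => L.summandwise vQ (g i)) '' P.latticePk j c = P.latticePk j c := by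
  refine image_preimage_eq_of_semiconj (LinearEquiv.surjective _) (fun y y' h => ?_)
    (P.comparison_factorwise g g' hg') (P.congr_image_summandLattice g' hlog c)
  funext e
  exact (PiTensorProduct.congr fun a => g' a (e a) : P.X e ≃ₗ[ℚ_[p]] P.X e).injective (congrFun h e)

/-- **(Ind2) maps `e⁻¹(Π_{v⃗} c·I_{v⃗})` onto itself** (families of `Ism`-elements of the presented signature).
[cite: DupuyHilado2025, §4.9] -/
theorem ism_image_latticePk (g : T.Caps j → ∀ v : T.Fibre vQ, L.carrier v.1 ≃ₗ[ℚ] L.carrier v.1)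
    (hg : ∀ i v, g i v ∈ L.ism v.1) (c : ℚ_[p]) :
    L.factorwise j vQ (fun i => L.summandwise vQ (g i)) '' P.latticePk j c = P.latticePk j c := by
  choose g' hg' using fun i v => P.ism_linear v (g i v) (hg i v)
  exact P.factorwise_image_latticePk g g' hg'
    (fun i v => P.image_logUnits_eq (hg' i v) (P.ism_shell v _ (hg i v))) c

/-- **The strip part of (Ind1) maps `e⁻¹(Π_{v⃗} c·I_{v⃗})` onto itself**. [cite: DupuyHilado2025, §4.7] -/
theorem strip_image_latticePk (g : T.Caps j → ∀ v : T.Fibre vQ, L.carrier v.1 ≃ₗ[ℚ] L.carrier v.1)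
    (hg : ∀ i v, g i v ∈ L.stripAut v.1) (c : ℚ_[p]) :
    L.factorwise j vQ (fun i => L.summandwise vQ (g i)) '' P.latticePk j c = P.latticePk j c := by
  choose g' hg' using fun i v => P.strip_linear v (g i v) (hg i v)
  exact P.factorwise_image_latticePk g g' hg'
    (fun i v => P.image_logUnits_eq (hg' i v) (P.strip_shell v _ (hg i v))) c

/-- **Every (Ind1)- or (Ind2)-FAMILY of c312-1 maps `e⁻¹(Π_{v⃗} c·I_{v⃗})` onto itself at `(j, v_ℚ)`** — the
hypothesis `hW` of c312-7's `hullDefined_of_stable` for `W = latticePk c` (Dupuy–Hilado §4: "induced by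
automorphisms of the `ℤ_p`-lattice `I^{⊗ j+1}_{V̲,p}`", "the Ind2 indeterminacies also preserve this lattice").
[cite: DupuyHilado2025, §4 (intro), §4.7, §4.9] -/
theorem family_image_latticePk {Φ : L.PacketAut} (hΦ : Φ ∈ L.Ind1Family ∪ L.Ind2Family) (j : T.Label)
    (c : ℚ_[p]) : Φ j vQ '' P.latticePk j c = P.latticePk j c := by
  rcases hΦ with hΦ | hΦ
  · obtain ⟨σ, h, hh, hΦj⟩ := hΦ j
    have hΦj' : Φ j vQ = (L.permute j vQ σ).trans
        (L.factorwise j vQ fun i => L.summandwise vQ fun v : T.Fibre vQ => h i v.1) := hΦj vQ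
    have hcomp : (⇑(Φ j vQ) : L.Packet j vQ → L.Packet j vQ) =
        ⇑(L.factorwise j vQ fun i => L.summandwise vQ fun v : T.Fibre vQ => h i v.1) ∘ ⇑(L.permute j vQ σ) := by
      rw [hΦj']; rfl
    rw [hcomp, Set.image_comp, P.permute_image_latticePk σ c]
    exact P.strip_image_latticePk (fun i v => h i v.1) (fun i v => hh i v.1) c
  · obtain ⟨g, hg, hΦj⟩ := hΦ j vQ
    rw [hΦj]
    exact P.ism_image_latticePk g hg c

/-- Hence every element of the indeterminacy subgroup `⟨Ind1Family ∪ Ind2Family⟩` (c312-7's `Setting.indGroup`)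
maps `e⁻¹(Π_{v⃗} c·I_{v⃗})` onto itself. [cite: DupuyHilado2025, §4 (intro)] -/
theorem image_latticePk_of_mem_closure {Φ : L.PacketAut}
    (hΦ : Φ ∈ Subgroup.closure (L.Ind1Family ∪ L.Ind2Family)) (j : T.Label) (c : ℚ_[p]) :
    Φ j vQ '' P.latticePk j c = P.latticePk j c := by
  induction hΦ using Subgroup.closure_induction with
  | mem Ψ hΨ => exact P.family_image_latticePk hΨ j c
  | one => simp
  | mul Ψ₁ Ψ₂ _ _ ih₁ ih₂ =>
    have hcomp : ⇑((Ψ₁ * Ψ₂) j vQ) = ⇑(Ψ₁ j vQ) ∘ ⇑(Ψ₂ j vQ) := by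
      funext x
      rfl
    rw [hcomp, Set.image_comp, ih₂, ih₁]
  | inv Ψ _ ih =>
    change ⇑((Ψ j vQ).symm) '' P.latticePk j c = P.latticePk j c
    conv_lhs => rw [← ih]
    rw [Set.image_image]
    simp only [LinearEquiv.symm_apply_apply, Set.image_id']

end Lattice

end PadicPresentation

end Cor312Vol

end IUTFork

end Summit.ABC

end
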